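import Summits.RiemannHypothesis.RiemannHypothesis.Theorems.JensenPolynomialsCapCertPrimitives
import Summits.RiemannHypothesis.RiemannHypothesis.Theorems.JensenCumulantSplit
import Summits.RiemannHypothesis.RiemannHypothesis.Theorems.JensenWindowTable

/-!
# Route `JensenPolynomials` — `XiCumulantMajorantCap` kernel packaging, part 3: the scaled recursion weights

RH-FREE, γ-FREE proof-of-data for the numeric route child `XiCumulantMajorantCap` (stmt-RiemannHypothesis-19217) of
route `JensenPolynomials` (rung J-P(P1′), cell rh-jensen, engine target ET1 «C2GEN-CERT»). Nothing here bears on the truth of RH.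
Closed forms `b̃_k = a(k)·M·x^k` (`x = √(d/M)`), `b̃_3 = (9/8)dx`, even/odd cases, the fixed-point dominations
`b̃_k ≤ b̃⁺_k/ONE`, `Σ_{2≤i<KK} b̃_{i+1} ≤ B_K⁺/ONE` and the geometric k-tail `Σ_{i≥KK} b̃_{i+1} ≤ T_K⁺/ONE`.
-/

-- D-0017: `Summit.RiemannHypothesis.RiemannHypothesis.…` duplicates the namespace BY DESIGN (single-problem summit).
set_option linter.dupNamespace false

namespace Summit.RiemannHypothesis.RiemannHypothesis.Theorems.JensenPolynomials.CapCert

open Finset Real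
open Summit.RiemannHypothesis.RiemannHypothesis.Theorems.JensenPolynomials
open Finset Real
open Summit.RiemannHypothesis.RiemannHypothesis.Theorems.JensenPolynomials

/-- `M_d > 0`, in `ℕ` and in `ℝ`. -/
theorem Mof_facts (d : ℕ) : 0 < Mof d ∧ (0 : ℝ) < (Mof d : ℝ) := by
  have h : 0 < Mof d := by unfold Mof; have := le_max_left 10000 (2 * d ^ 3); omega
  exact ⟨h, by exact_mod_cast h⟩

/-- The scale `λ = √(d/2)`: `λ > 0` (for `d ≥ 3`) and `λ² = d/2`. -/
theorem lam_facts {d : ℕ} (hd : 3 ≤ d) : 0 < lam d ∧ lam d ^ 2 = (d : ℝ) / 2 := by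
  have h3 : (3 : ℝ) ≤ d := by exact_mod_cast hd
  refine ⟨?_, ?_⟩
  · unfold lam; apply Real.sqrt_pos.mpr; linarith
  · unfold lam; rw [Real.sq_sqrt (by positivity)]

/-- `x = √(d/M)`: `x ≥ 0` and `x² = d/M`. -/
theorem xr_facts (d : ℕ) : 0 ≤ xr d ∧ xr d ^ 2 = (d : ℝ) / (Mof d : ℝ) := by
  refine ⟨Real.sqrt_nonneg _, ?_⟩
  unfold xr; rw [Real.sq_sqrt (div_nonneg (Nat.cast_nonneg _) ((Mof_facts d).2).le)]

/-- Signs of the cap data of degree `d`: the caps `c_k`, the weights `b̃_k`, the coefficients `e_j`, the scaled `ẽ_j` are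
all `≥ 0`, and `ẽ_0 = 1`. -/
theorem cap_facts (d : ℕ) : (∀ k, 0 ≤ capFun d k) ∧ (∀ k, 0 ≤ bt d k) ∧ (∀ j, 0 ≤ cumulantCoeff (capFun d) j) ∧
    (∀ j, 0 ≤ et d j) ∧ et d 0 = 1 := by
  have hc : ∀ k, 0 ≤ capFun d k := by
    intro k
    unfold capFun
    have hM : (0 : ℝ) < ((max 10000 (2 * d ^ 3) + d : ℕ) : ℝ) := (Mof_facts d).2
    apply div_nonneg
    · apply mul_nonneg (mul_nonneg _ (Nat.cast_nonneg _)) (Real.rpow_nonneg (by norm_num) _)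
      split_ifs <;> positivity
    · exact Real.rpow_nonneg hM.le _
  have he : ∀ j, 0 ≤ cumulantCoeff (capFun d) j := fun j =>
    (cumulantCoeff_abs_le (capFun d) (capFun d) j (fun k _ _ => by rw [abs_of_nonneg (hc k)]) j le_rfl).2
  refine ⟨hc, fun k => ?_, he, fun j => mul_nonneg (he j) (pow_nonneg (Real.sqrt_nonneg _) _),
    by simp [et, cumulantCoeff]⟩
  unfold bt
  exact div_nonneg (mul_nonneg (hc k) (pow_nonneg (Real.sqrt_nonneg _) _)) (Nat.cast_nonneg _)

/-- `b̃_k ≥ 0` and `c_k ≥ 0` (projections of `cap_facts`, used constantly). -/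
theorem bt_nonneg (d k : ℕ) : 0 ≤ bt d k ∧ 0 ≤ capFun d k := ⟨(cap_facts d).2.1 k, (cap_facts d).1 k⟩

/-- `ẽ_j ≥ 0` and `e_j ≥ 0` (projections of `cap_facts`, used constantly). -/
theorem et_nonneg (d j : ℕ) : 0 ≤ et d j ∧ 0 ≤ cumulantCoeff (capFun d) j :=
  ⟨(cap_facts d).2.2.2.1 j, (cap_facts d).2.2.1 j⟩

/-- **The scaled weights in closed form: `b̃_k = a(k)·M·x^k`, `x = √(d/M)` (`k ≥ 1`).** -/
theorem bt_eq (d k : ℕ) (hk : 1 ≤ k) : bt d k = acoef k * (Mof d : ℝ) * xr d ^ k := by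
  have hM := (Mof_facts d).2
  have hMeq : ((max 10000 (2 * d ^ 3) + d : ℕ) : ℝ) = (Mof d : ℝ) := by simp [Mof]
  have hfac : (Nat.factorial (k - 1) : ℝ) ≠ 0 := by positivity
  unfold bt capFun
  rw [hMeq]
  have h2 : (2 : ℝ) ^ ((k : ℝ) / 2) = (√2) ^ k := rpow_half_eq_sqrt_pow (by norm_num) k
  have hMk : (Mof d : ℝ) ^ (((k : ℝ) - 2) / 2) = (√(Mof d : ℝ)) ^ k / (Mof d : ℝ) := by
    have : ((k : ℝ) - 2) / 2 = (k : ℝ) / 2 - 1 := by ring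
    rw [this, Real.rpow_sub hM, Real.rpow_one, rpow_half_eq_sqrt_pow hM.le]
  rw [h2, hMk]
  have hlam : √2 * lam d = √(d : ℝ) := by
    unfold lam; rw [← Real.sqrt_mul (by norm_num : (0:ℝ) ≤ 2)]; congr 1; ring
  have hx : xr d = √(d : ℝ) / √(Mof d : ℝ) := by
    unfold xr; rw [Real.sqrt_div' _ hM.le]
  have hsM : 0 < √(Mof d : ℝ) := Real.sqrt_pos.mpr hM
  rw [hx, div_pow, ← hlam, mul_pow]
  simp only [acoef]
  field_simp

/-- `a(k) = k·4^k/192` for `k ≥ 4`. -/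
theorem acoef_eq_of_ge {k : ℕ} (hk : 4 ≤ k) : acoef k = (k : ℝ) * 4 ^ k / 192 := by
  unfold acoef
  rw [if_neg (by omega)]
  have : (4 : ℝ) ^ k = 4 ^ (k - 3) * 4 ^ 3 := by rw [← pow_add]; congr 1; omega
  rw [this]; ring

/-- **`b̃_3 = (9/8)·d·x`.** -/
theorem bt_three (d : ℕ) : bt d 3 = 9 / 8 * (d : ℝ) * xr d := by
  rw [bt_eq d 3 (by norm_num)]
  have hM := (Mof_facts d).2
  have : xr d ^ 3 = xr d ^ 2 * xr d := by ring
  rw [this, (xr_facts d).2]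
  simp only [acoef, le_refl, if_true]
  field_simp

/-- **`b̃_k = (k/192)·M·y^k` with `y = 4x`, for `k ≥ 4`.** -/
theorem bt_eq_y {d k : ℕ} (hk : 4 ≤ k) : bt d k = (k : ℝ) / 192 * (Mof d : ℝ) * (4 * xr d) ^ k := by
  rw [bt_eq d k (by omega), acoef_eq_of_ge hk, mul_pow]; ring

/-- Even case `k = 2m ≥ 4`: `b̃_k = k·M·(16d)^m / (192·M^m)`. -/
theorem bt_even {d m : ℕ} (hm : 2 ≤ m) :
    bt d (2 * m) = ((2 * m : ℕ) : ℝ) * (Mof d : ℝ) * (16 * (d : ℝ)) ^ m / (192 * (Mof d : ℝ) ^ m) := by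
  rw [bt_eq_y (by omega : 4 ≤ 2 * m)]
  have hM := (Mof_facts d).2
  have : (4 * xr d) ^ (2 * m) = (16 * (xr d ^ 2)) ^ m := by rw [pow_mul]; ring
  rw [this, (xr_facts d).2, show (16 : ℝ) * ((d : ℝ) / (Mof d : ℝ)) = 16 * (d : ℝ) / (Mof d : ℝ) by ring, div_pow]
  field_simp

/-- Odd case `k = 2m+1 ≥ 5`: `b̃_k = (k·M·(16d)^m / (192·M^m))·(4x)`. -/
theorem bt_odd {d m : ℕ} (hm : 2 ≤ m) :
    bt d (2 * m + 1) = ((2 * m + 1 : ℕ) : ℝ) * (Mof d : ℝ) * (16 * (d : ℝ)) ^ m / (192 * (Mof d : ℝ) ^ m)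
      * (4 * xr d) := by
  rw [bt_eq_y (by omega : 4 ≤ 2 * m + 1)]
  have hM := (Mof_facts d).2
  have : (4 * xr d) ^ (2 * m + 1) = (16 * (xr d ^ 2)) ^ m * (4 * xr d) := by rw [pow_succ, pow_mul]; ring
  rw [this, (xr_facts d).2, show (16 : ℝ) * ((d : ℝ) / (Mof d : ℝ)) = 16 * (d : ℝ) / (Mof d : ℝ) by ring, div_pow]
  field_simp

/-! ### Fixed-point upper bounds of `x`, `b̃_k`, `B_K`, `T_K` -/

/-- `x ≤ x⁺/ONE`. -/
theorem xr_le (d : ℕ) : xr d ≤ (xU d : ℝ) / ONE := by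
  unfold xr xU
  exact sqrtU_ge (ofRatU_ge d (Mof d) (by exact_mod_cast (Mof_facts d).2))

/-- `b̃_k ≤ b̃⁺_k` for `k ≥ 3`. -/
theorem bt_le_btUx (d : ℕ) {k : ℕ} (hk : 3 ≤ k) : bt d k ≤ (btUx d (xU d) k : ℝ) / ONE := by
  have hM := (Mof_facts d).2
  have hx := xr_le d
  have hx0 := (xr_facts d).1
  unfold btUx
  by_cases h3 : k = 3
  · subst h3
    simp only [if_true]
    rw [bt_three]
    have h := div_le_cdiv (9 * d * xU d) 8 (by norm_num)
    rw [le_div_iff₀ ONE_facts.1]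
    refine le_trans ?_ h
    push_cast
    rw [le_div_iff₀ (by norm_num : (0:ℝ) < 8)]
    have : xr d * ONE ≤ (xU d : ℝ) := by rwa [le_div_iff₀ ONE_facts.1] at hx
    nlinarith [Nat.cast_nonneg (α := ℝ) d]
  · rw [if_neg h3]
    have hk4 : 4 ≤ k := by omega
    obtain ⟨m, hm | hm⟩ := Nat.even_or_odd' k
    · -- even
      have hm2 : 2 ≤ m := by omega
      have hmod : k % 2 = 0 := by omega
      have hdiv : k / 2 = m := by omega
      rw [if_pos hmod, hdiv, hm, bt_even hm2]
      have hq : 0 < 192 * Mof d ^ m := by have := (Mof_facts d).1; positivity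
      have := ofRatU_ge (2 * m * Mof d * (16 * d) ^ m) (192 * Mof d ^ m) hq
      push_cast at this ⊢
      exact this
    · -- odd
      have hm2 : 2 ≤ m := by omega
      have hmod : ¬ k % 2 = 0 := by omega
      have hdiv : k / 2 = m := by omega
      rw [if_neg hmod, hdiv, hm, bt_odd hm2]
      have hq : 0 < 192 * Mof d ^ m := by have := (Mof_facts d).1; positivity
      have h1 := ofRatU_ge ((2 * m + 1) * Mof d * (16 * d) ^ m) (192 * Mof d ^ m) hq
      apply mulU_ge
      · positivity
      · positivity
      · push_cast at h1 ⊢; exact h1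
      · have h4 : (4 : ℝ) * xr d ≤ 4 * ((xU d : ℝ) / ONE) := by linarith
        push_cast; rw [mul_div_assoc]; exact h4

/-- Indicator form of `B_K`: `Σ_{i<n, 2≤i<KK} b̃_{i+1} ≤ B_K⁺` for every `n`. -/
theorem sumBK_le (d n : ℕ) :
    ∑ i ∈ range n, (if 2 ≤ i ∧ i < KK then bt d (i + 1) else 0)
      ≤ (BKof (btListx d (xU d)) : ℝ) / ONE := by
  have key : ∑ i ∈ range n, (if 2 ≤ i ∧ i < KK then bt d (i + 1) else 0)
      ≤ ∑ i ∈ range KK, (if 2 ≤ i ∧ i < KK then bt d (i + 1) else 0) := by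
    rcases Nat.lt_or_ge KK n with h | h
    swap
    · exact Finset.sum_le_sum_of_subset_of_nonneg (Finset.range_mono h)
        (fun i _ _ => by split_ifs; exacts [(bt_nonneg d _).1, le_rfl])
    · rw [← Finset.sum_range_add_sum_Ico _ h.le]
      have : ∑ i ∈ Ico KK n, (if 2 ≤ i ∧ i < KK then bt d (i + 1) else 0) = 0 :=
        Finset.sum_eq_zero (fun i hi => by rw [Finset.mem_Ico] at hi; rw [if_neg (by omega)])
      rw [this, add_zero]
  refine key.trans ?_
  unfold BKof
  rw [Nat.cast_sum, Finset.sum_div]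
  apply Finset.sum_le_sum
  intro i hi
  rw [Finset.mem_range] at hi
  by_cases h2 : 2 ≤ i
  · rw [if_pos ⟨h2, hi⟩, if_pos h2, btListx_getD h2 hi]
    exact bt_le_btUx d (by omega)
  · have hn : ¬ (2 ≤ i ∧ i < KK) := fun h => h2 h.1
    rw [if_neg hn, if_neg h2]; simp

/-- The geometric comparison `(KK+1+l)·y^{KK+1+l} ≤ (KK+1)·y^{KK+1}·y'^l`, `y' = (KK+2)y/(KK+1)`. -/
theorem ky_pow_le {y : ℝ} (hy : 0 ≤ y) (l : ℕ) :
    ((KK + 1 + l : ℕ) : ℝ) * y ^ (KK + 1 + l) ≤ (KK + 1 : ℝ) * y ^ (KK + 1) * (((KK + 2 : ℝ) / (KK + 1)) * y) ^ l := by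
  induction l with
  | zero => simp
  | succ l ih =>
    have hY : 0 ≤ y ^ (KK + 1 + l) := pow_nonneg hy _
    have step : ((KK + 1 + (l + 1) : ℕ) : ℝ) * y ^ (KK + 1 + (l + 1))
        ≤ (((KK + 2 : ℝ) / (KK + 1)) * y) * (((KK + 1 + l : ℕ) : ℝ) * y ^ (KK + 1 + l)) := by
      have : y ^ (KK + 1 + (l + 1)) = y * y ^ (KK + 1 + l) := by ring
      rw [this]
      have hc : ((KK + 1 + (l + 1) : ℕ) : ℝ) * (KK + 1) ≤ (KK + 2 : ℝ) * ((KK + 1 + l : ℕ) : ℝ) := by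
        push_cast; nlinarith
      have hK : (0 : ℝ) < KK + 1 := by positivity
      rw [div_mul_eq_mul_div, div_mul_eq_mul_div, le_div_iff₀ hK]
      nlinarith [mul_nonneg hy hY]
    refine step.trans ?_
    have hy' : 0 ≤ ((KK + 2 : ℝ) / (KK + 1)) * y := by positivity
    calc (((KK + 2 : ℝ) / (KK + 1)) * y) * (((KK + 1 + l : ℕ) : ℝ) * y ^ (KK + 1 + l))
        ≤ (((KK + 2 : ℝ) / (KK + 1)) * y) * ((KK + 1 : ℝ) * y ^ (KK + 1) * (((KK + 2 : ℝ) / (KK + 1)) * y) ^ l) :=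
          mul_le_mul_of_nonneg_left ih hy'
      _ = (KK + 1 : ℝ) * y ^ (KK + 1) * (((KK + 2 : ℝ) / (KK + 1)) * y) ^ (l + 1) := by ring

/-- **The k-tail bound: `Σ_{i<n, KK≤i} b̃_{i+1} ≤ T_K⁺` for every `n` (given `y'⁺ < ONE`).** -/
theorem sumTail_le (d n : ℕ) (hyp : ypOf (xU d) < ONE) :
    ∑ i ∈ range n, (if KK ≤ i then bt d (i + 1) else 0) ≤ (Tof d (xU d) : ℝ) / ONE := by
  have hy0 : 0 ≤ 4 * xr d := mul_nonneg (by norm_num) (xr_facts d).1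
  set y := 4 * xr d with hy_def
  have hyU : y ≤ ((4 * xU d : ℕ) : ℝ) / ONE := by
    push_cast; rw [hy_def, mul_div_assoc]; exact mul_le_mul_of_nonneg_left (xr_le d) (by norm_num)
  set y' := ((KK + 2 : ℝ) / (KK + 1)) * y with hy'_def
  have hy'U : y' ≤ (ypOf (xU d) : ℝ) / ONE := by
    unfold ypOf
    have h := div_le_cdiv ((KK + 2) * (4 * xU d)) (KK + 1) (by norm_num)
    rw [le_div_iff₀ ONE_facts.1]
    refine le_trans ?_ h
    rw [le_div_iff₀ (by positivity)]
    have : y * ONE ≤ ((4 * xU d : ℕ) : ℝ) := by rwa [le_div_iff₀ ONE_facts.1] at hyU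
    rw [hy'_def]; push_cast at this ⊢
    have hK : (0:ℝ) < KK + 1 := by positivity
    field_simp
    nlinarith
  have hy'1 : y' < 1 := by
    have : (ypOf (xU d) : ℝ) / ONE < 1 := by
      rw [div_lt_one ONE_facts.1]; exact_mod_cast hyp
    linarith
  have hy'0 : 0 ≤ y' := by positivity
  -- finite geometric sums of a ratio in `[0,1)` are `≤ 1/(1−r)`
  have geom_sum_le_inv : ∀ n : ℕ, ∑ i ∈ range n, y' ^ i ≤ 1 / (1 - y') := fun n => by
    have h := geom_sum_mul y' n
    rw [le_div_iff₀ (by linarith)]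
    nlinarith [pow_nonneg hy'0 n]
  -- reduce to the sum over `Ico KK n`
  have hM := (Mof_facts d).2
  -- termwise bound by the geometric majorant
  have hterm : ∀ i ∈ range n, (if KK ≤ i then bt d (i + 1) else 0)
      ≤ (if KK ≤ i then (Mof d : ℝ) / 192 * ((KK + 1 : ℝ) * y ^ (KK + 1)) * y' ^ (i - KK) else 0) := by
    intro i _
    split_ifs with h
    · rw [bt_eq_y (by unfold KK at h; omega : 4 ≤ i + 1)]
      have := ky_pow_le hy0 (i - KK)
      have hi : KK + 1 + (i - KK) = i + 1 := by omega
      rw [hi] at this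
      push_cast at this ⊢
      have hM' : 0 ≤ (Mof d : ℝ) / 192 := by positivity
      calc ((i : ℝ) + 1) / 192 * (Mof d : ℝ) * y ^ (i + 1) = (Mof d : ℝ) / 192 * (((i : ℝ) + 1) * y ^ (i + 1)) := by ring
        _ ≤ (Mof d : ℝ) / 192 * ((KK + 1 : ℝ) * y ^ (KK + 1) * y' ^ (i - KK)) :=
            mul_le_mul_of_nonneg_left this hM'
        _ = _ := by ring
    · exact le_rfl
  refine (Finset.sum_le_sum hterm).trans ?_
  -- the majorant sum is ≤ (M/192)(KK+1)y^{KK+1} · 1/(1−y')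
  have hgeo : ∑ i ∈ range n, (if KK ≤ i then (Mof d : ℝ) / 192 * ((KK + 1 : ℝ) * y ^ (KK + 1)) * y' ^ (i - KK) else 0)
      ≤ (Mof d : ℝ) / 192 * ((KK + 1 : ℝ) * y ^ (KK + 1)) * (1 / (1 - y')) := by
    rcases Nat.lt_or_ge KK n with h | h
    swap
    · rw [Finset.sum_eq_zero (fun i hi => by rw [Finset.mem_range] at hi; rw [if_neg (by omega)])]
      have : 0 ≤ 1 / (1 - y') := by apply div_nonneg zero_le_one; linarith
      exact mul_nonneg (by positivity) this
    · rw [← Finset.sum_range_add_sum_Ico _ h.le,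
        Finset.sum_eq_zero (fun i hi => by rw [Finset.mem_range] at hi; rw [if_neg (by omega)]), zero_add]
      rw [Finset.sum_Ico_eq_sum_range]
      have : ∑ k ∈ range (n - KK), (if KK ≤ KK + k then (Mof d : ℝ) / 192 * ((KK + 1 : ℝ) * y ^ (KK + 1)) * y' ^ (KK + k - KK) else 0)
          = (Mof d : ℝ) / 192 * ((KK + 1 : ℝ) * y ^ (KK + 1)) * ∑ k ∈ range (n - KK), y' ^ k := by
        rw [Finset.mul_sum]
        apply Finset.sum_congr rfl
        intro k _
        rw [if_pos (by omega), Nat.add_sub_cancel_left]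
      rw [this]
      exact mul_le_mul_of_nonneg_left (geom_sum_le_inv _) (by positivity)
  refine hgeo.trans ?_
  -- compare with the fixed-point `Tof`
  unfold Tof
  have hden : 0 < ONE - ypOf (xU d) := Nat.sub_pos_of_lt hyp
  have hc := div_le_cdiv (ofRatU (Mof d * (KK + 1)) 192 * powU (4 * xU d) (KK + 1)) (ONE - ypOf (xU d)) hden
  rw [le_div_iff₀ ONE_facts.1]
  refine le_trans ?_ hc
  have hdenR : (0 : ℝ) < ((ONE - ypOf (xU d) : ℕ) : ℝ) := by exact_mod_cast hden
  rw [le_div_iff₀ hdenR]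
  have h1 : (Mof d : ℝ) / 192 * (KK + 1 : ℝ) ≤ (ofRatU (Mof d * (KK + 1)) 192 : ℝ) / ONE := by
    have := ofRatU_ge (Mof d * (KK + 1)) 192 (by norm_num)
    have e : (Mof d : ℝ) / 192 * (KK + 1 : ℝ) = ((Mof d * (KK + 1) : ℕ) : ℝ) / ((192 : ℕ) : ℝ) := by
      push_cast; ring
    rw [e]; exact this
  have h2 : y ^ (KK + 1) ≤ (powU (4 * xU d) (KK + 1) : ℝ) / ONE := powU_ge hy0 hyU _
  have h3 : (1 : ℝ) - y' ≥ ((ONE - ypOf (xU d) : ℕ) : ℝ) / ONE := by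
    rw [Nat.cast_sub hyp.le, sub_div, div_self ONE_facts.2.1]
    linarith
  have h4 : 0 < 1 - y' := by linarith
  -- assemble: A·B·(1/(1−y'))·ONE·(ONE−yp) ≤ A⁺·B⁺  where A ≤ A⁺/ONE, B ≤ B⁺/ONE, (ONE−yp)/ONE ≤ 1−y'
  have hA0 : 0 ≤ (Mof d : ℝ) / 192 * (KK + 1 : ℝ) := by positivity
  have hB0 : 0 ≤ y ^ (KK + 1) := pow_nonneg hy0 _
  have hAB : (Mof d : ℝ) / 192 * (KK + 1 : ℝ) * y ^ (KK + 1)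
      ≤ (ofRatU (Mof d * (KK + 1)) 192 : ℝ) / ONE * ((powU (4 * xU d) (KK + 1) : ℝ) / ONE) :=
    mul_le_mul h1 h2 hB0 (hA0.trans h1)
  have hE : ((ONE - ypOf (xU d) : ℕ) : ℝ) ≤ (1 - y') * ONE := by
    have := h3; rw [ge_iff_le, div_le_iff₀ ONE_facts.1] at this; exact this
  calc (Mof d : ℝ) / 192 * ((KK + 1 : ℝ) * y ^ (KK + 1)) * (1 / (1 - y')) * ONE * ((ONE - ypOf (xU d) : ℕ) : ℝ)
      ≤ (Mof d : ℝ) / 192 * ((KK + 1 : ℝ) * y ^ (KK + 1)) * (1 / (1 - y')) * ONE * ((1 - y') * ONE) := by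
        apply mul_le_mul_of_nonneg_left hE; positivity
    _ = ((Mof d : ℝ) / 192 * (KK + 1 : ℝ) * y ^ (KK + 1)) * ONE * ONE := by field_simp
    _ ≤ ((ofRatU (Mof d * (KK + 1)) 192 : ℝ) / ONE * ((powU (4 * xU d) (KK + 1) : ℝ) / ONE)) * ONE * ONE := by
        gcongr
    _ = ((ofRatU (Mof d * (KK + 1)) 192 * powU (4 * xU d) (KK + 1) : ℕ) : ℝ) := by
        have hO : (ONE : ℝ) ≠ 0 := ONE_facts.2.1
        push_cast; field_simp

end Summit.RiemannHypothesis.RiemannHypothesis.Theorems.JensenPolynomials.CapCert
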